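/-
Copyright (c) 2026. All rights reserved.
Released under Apache 2.0 license as described in the file LICENSE.
Authors: abc-iut cell, fact-proving seat abc-iut-f-074 (block F, tranche 74; Def 3.5 toolkit for the
exact criterion behind [AbsTopIII] Cor 3.7 (iv)).
-/
import Literature.AnabelianGeometry.AbsoluteAnabelian.PseudoShadows

/-!
# Families of homotopies from a LAX system of 2-cells on a pseudo-commuting shadow
# ([AbsTopIII] Def 3.5 (ii); technical companion of `PseudoShadows.lean`)

S. Mochizuki, *Topics in Absolute Anabelian Geometry III* (`MochizukiAbsTopIII2015`; locators =
kurims manuscript pages, lit key `paper:url-5493eb38cbb7`), Def 3.5 (i)–(ii) pp. 74–75.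

Seat abc-iut-L4-t12's `PseudoShadows.lean` builds, from a pseudo-commuting shadow `(Sh, aug, sh, can)`
of a diagram of categories `𝒟` with FULLY FAITHFUL augmentations, the family of homotopies whose
boundary set is "equal shadows `sh_[γ₁] = sh_[γ₂]`": the homotopy of such a pair is the unique natural
transformation `𝒟_[γ₁] ⟶ 𝒟_[γ₂]` lying over `can_[γ₁] ≫ can_[γ₂]⁻¹`.  That covers cores, telecores and
the family `ℋ_δ` of Cor 3.7 (ii), whose homotopies are all isomorphisms.  The observables `𝔖_log`,
`𝔖†_log` of Cor 3.6 (iii) / 3.7 (iii) — and therefore the INCOMPATIBILITY statements of Cor 3.6 (iv) /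
3.7 (iv), which ask whether ONE family contains the telecore homotopies AND the non-invertible
homotopies `ι_×`, `ι_{log,⋎}` — need pairs with DIFFERENT shadows related by a prescribed 2-cell.  This
file is the lax generalisation, once for all consumers:

* `PseudoShadow.luniv hb p q σ` — for a 2-cell `σ : sh_[γ₁] ⟶ sh_[γ₂]` between the shadows of a
  co-verticial pair and a fully faithful augmentation at the terminal vertex, THE natural transformation
  `𝒟_[γ₁] ⟶ 𝒟_[γ₂]` lying over `can_[γ₁] ≫ (aug ◃ σ) ≫ can_[γ₂]⁻¹` (`map_luniv_app`, uniqueness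
  `luniv_eq`); identity / composition / whiskering laws `luniv_id`, `luniv_comp`, `luniv_whisker`
  (t12's `univ` is the case `σ = eqToHom`);
* `PseudoShadow.LaxCells` — a COHERENT SYSTEM of shadow 2-cells: a saturated set `R` of co-verticial
  pairs, a 2-cell `σ_ϖ : sh_[γ₁] ⟶ sh_[γ₂]` for each `ϖ ∈ R` with the identity / composition / whiskering
  laws of Def 3.5 (ii) ON THE SHADOW, and a set of admissible terminal vertices (`good`) at which the
  augmentation is fully faithful;
* `PseudoShadow.laxFamily` — the family of homotopies on `𝒟` it determines (boundary set `R`, homotopies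
  `luniv σ_ϖ`; a `HomotopyFamily` in the sense of abc-iut-L4-t2 via `mkOfStrict`), with the computation
  rule `map_laxFamily_η_app` and the uniqueness principle `laxFamily_η_eq` used to identify pinned
  homotopies.

Pure category theory (whiskering / `eqToHom` bookkeeping); nothing here bears on [IUTchIII] Cor 3.12.
-/

namespace Literature.AnabelianGeometry.AbsoluteAnabelian

open _root_.CategoryTheory _root_.Quiver

universe v u w

namespace DiagramOfCategories

variable {V : Type w} [Quiver.{v} V] {D : DiagramOfCategories.{v, u, w} V} (S : D.PseudoShadow)

namespace PseudoShadow

/-! ## The lax universal homotopy of a pair with a 2-cell between its shadows -/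

section LaxUniversal

variable {a b : V} (hb : (S.aug b).FullyFaithful)

/-- **The lax universal homotopy**: for a co-verticial pair `([γ₁],[γ₂])` and a 2-cell
`σ : sh_[γ₁] ⟶ sh_[γ₂]` between its shadows, the unique natural transformation `𝒟_[γ₁] ⟶ 𝒟_[γ₂]` lying
over `can_[γ₁] ≫ (aug ◃ σ) ≫ can_[γ₂]⁻¹` (the augmentation at the terminal vertex being fully faithful).
[cite: MochizukiAbsTopIII2015, Definition 3.5 (ii) p.75] -/
noncomputable def luniv (p q : Path a b) (σ : S.shP p ⟶ S.shP q) :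
    D.pathFunctor' p ⟶ D.pathFunctor' q :=
  (hb.whiskeringRight (D.obj a)).preimage
    ((S.canP p).hom ≫ Functor.whiskerLeft (S.aug a) σ ≫ (S.canP q).inv)

/-- The lax universal homotopy lies over `can_[γ₁] ≫ σ ≫ can_[γ₂]⁻¹` (components).
[cite: MochizukiAbsTopIII2015, Definition 3.5 (ii) p.75] -/
theorem map_luniv_app (p q : Path a b) (σ : S.shP p ⟶ S.shP q) (x : D.obj a) :
    (S.aug b).map ((S.luniv hb p q σ).app x) =
      S.canH p x ≫ σ.app ((S.aug a).obj x) ≫ S.canI q x := by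
  unfold luniv
  rw [Functor.FullyFaithful.whiskeringRight_preimage_app, Functor.FullyFaithful.map_preimage,
    NatTrans.comp_app, NatTrans.comp_app, Functor.whiskerLeft_app]
  rfl

/-- **Uniqueness**: a natural transformation lying over `can_[γ₁] ≫ σ ≫ can_[γ₂]⁻¹` IS the lax universal
homotopy. [cite: MochizukiAbsTopIII2015, Definition 3.5 (ii) p.75] -/
theorem luniv_eq {p q : Path a b} (σ : S.shP p ⟶ S.shP q) (φ : D.pathFunctor' p ⟶ D.pathFunctor' q)
    (hφ : ∀ x, (S.aug b).map (φ.app x) = S.canH p x ≫ σ.app ((S.aug a).obj x) ≫ S.canI q x) :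
    φ = S.luniv hb p q σ := by
  ext x
  exact hb.map_injective ((hφ x).trans (S.map_luniv_app hb p q σ x).symm)

/-- Axiom `ζ_{([γ],[γ])} = id`: the lax universal homotopy over the identity 2-cell is the identity.
[cite: MochizukiAbsTopIII2015, Definition 3.5 (ii) p.75] -/
theorem luniv_id (p : Path a b) : S.luniv hb p p (𝟙 _) = 𝟙 _ :=
  (S.luniv_eq hb (𝟙 _) (𝟙 _) fun x => by simp).symm

/-- Axiom `ζ_{ϖ''} = ζ_{ϖ'} ∘ ζ_ϖ`: lax universal homotopies compose as their 2-cells do.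
[cite: MochizukiAbsTopIII2015, Definition 3.5 (ii) p.75] -/
theorem luniv_comp (p q r : Path a b) (σ : S.shP p ⟶ S.shP q) (τ : S.shP q ⟶ S.shP r) :
    S.luniv hb p r (σ ≫ τ) = S.luniv hb p q σ ≫ S.luniv hb q r τ :=
  (S.luniv_eq hb _ _ fun x => by
    rw [NatTrans.comp_app, Functor.map_comp, map_luniv_app, map_luniv_app]
    simp only [Category.assoc, canI_canH_assoc, NatTrans.comp_app]).symm

/-- The lax universal homotopy only depends on the 2-cell. [cite: MochizukiAbsTopIII2015, Definition 3.5 (ii) p.75] -/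
theorem luniv_congr {p q : Path a b} {σ σ' : S.shP p ⟶ S.shP q} (h : σ = σ') :
    S.luniv hb p q σ = S.luniv hb p q σ' := by
  rw [h]

end LaxUniversal

/-! ## The whiskering axiom -/

/-- The shadow of `𝒟_[γ₂](ζ_x)` for `ζ_x` lying over `u ≫ u'`, via a natural family `ch` with right
inverse `ci` (as in `PseudoShadows.lean`). [folklore] -/
private theorem shadow_whisker_aux' {A B C Y Y₀ Z : Type u} [Category.{v} A] [Category.{v} B]
    [Category.{v} C] [Category.{v} Y] [Category.{v} Y₀] [Category.{v} Z]
    {P Q : A ⥤ B} {R : B ⥤ C} {tB : B ⥤ Y} {tC : C ⥤ Z} {sP : Y₀ ⥤ Y} (sR : Y ⥤ Z)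
    (ch : ∀ z : B, tC.obj (R.obj z) ⟶ sR.obj (tB.obj z))
    (ci : ∀ z : B, sR.obj (tB.obj z) ⟶ tC.obj (R.obj z))
    (hnat : ∀ {z z' : B} (g : z ⟶ z'), tC.map (R.map g) ≫ ch z' = ch z ≫ sR.map (tB.map g))
    (hci : ∀ z : B, ch z ≫ ci z = 𝟙 _)
    {y : A} {t : Y₀} (f : P.obj y ⟶ Q.obj y)
    (u : tB.obj (P.obj y) ⟶ sP.obj t) (u' : sP.obj t ⟶ tB.obj (Q.obj y)) (hf : tB.map f = u ≫ u') :
    tC.map (R.map f) = ch (P.obj y) ≫ sR.map u ≫ sR.map u' ≫ ci (Q.obj y) := by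
  have nat := congrArg (· ≫ ci (Q.obj y)) (hnat f)
  simp only [Category.assoc, hci, Category.comp_id] at nat
  rw [nat, hf, Functor.map_comp, Category.assoc]

/-- `H(P u) ≫ H(σ_t) ≫ H(Q u') = H(σ_s)` for a natural `σ : P ⟶ Q` and `u ≫ u' = id` (the lax
replacement of the strict cancellation `H(F u) ≫ H(F u') = id`). [folklore] -/
private theorem lax_cancel {A B C : Type u} [Category.{v} A] [Category.{v} B] [Category.{v} C]
    {P Q : A ⥤ B} (σ : P ⟶ Q) (H : B ⥤ C) {s t : A} (u : s ⟶ t) (u' : t ⟶ s)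
    (huu' : u ≫ u' = 𝟙 s) {W : C} (k : H.obj (Q.obj s) ⟶ W) :
    H.map (P.map u) ≫ H.map (σ.app t) ≫ H.map (Q.map u') ≫ k = H.map (σ.app s) ≫ k := by
  rw [← Category.assoc (H.map (P.map u)), ← H.map_comp, σ.naturality u, H.map_comp,
    Category.assoc, ← Category.assoc (H.map (Q.map u)), ← H.map_comp, ← Q.map_comp, huu',
    Q.map_id, H.map_id, Category.id_comp]

/-- **Whiskering axiom** `ζ_{([γ₃]∘[γ₁]∘[γ₄],[γ₃]∘[γ₂]∘[γ₄])} = 𝒟_[γ₃] ∘ ζ_ϖ ∘ 𝒟_[γ₄]` for lax universal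
homotopies: if the 2-cell `σ'` of the whiskered pair is (componentwise) the whiskering
`sh_[γ₃] ∘ σ ∘ sh_[γ₄]` of the 2-cell `σ` of `ϖ`, the lax universal homotopy over `σ'` is the whiskering
of the one over `σ`. [cite: MochizukiAbsTopIII2015, Definition 3.5 (ii) p.75] -/
theorem luniv_whisker {a b c d : V} (hb : (S.aug b).FullyFaithful) (hd : (S.aug d).FullyFaithful)
    (p q : Path a b) (σ : S.shP p ⟶ S.shP q) (r₁ : Path c a) (r₂ : Path b d)
    (σ' : S.shP (r₁.comp (p.comp r₂)) ⟶ S.shP (r₁.comp (q.comp r₂)))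
    (hσ' : ∀ y : S.Sh c, σ'.app y =
      eqToHom (by rw [S.shP_comp_obj, S.shP_comp_obj]) ≫
        (S.shP r₂).map (σ.app ((S.shP r₁).obj y)) ≫
        eqToHom (by rw [S.shP_comp_obj, S.shP_comp_obj]))
    (h₁ : D.pathFunctor' (r₁.comp (p.comp r₂)) =
      D.pathFunctor' r₁ ⋙ D.pathFunctor' p ⋙ D.pathFunctor' r₂)
    (h₂ : D.pathFunctor' r₁ ⋙ D.pathFunctor' q ⋙ D.pathFunctor' r₂ =
      D.pathFunctor' (r₁.comp (q.comp r₂))) :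
    S.luniv hd (r₁.comp (p.comp r₂)) (r₁.comp (q.comp r₂)) σ' =
      eqToHom h₁ ≫ Functor.whiskerLeft (D.pathFunctor' r₁)
        (Functor.whiskerRight (S.luniv hb p q σ) (D.pathFunctor' r₂)) ≫ eqToHom h₂ := by
  symm
  refine S.luniv_eq hd σ' _ fun x => ?_
  rw [NatTrans.comp_app, NatTrans.comp_app, eqToHom_app, eqToHom_app, Functor.whiskerLeft_app,
    Functor.whiskerRight_app, Functor.map_comp, Functor.map_comp, eqToHom_map, eqToHom_map, hσ']
  symm
  refine (conj_eqToHom_iff_heq' _ _ _ _).mpr ?_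
  show _ ≍ (S.aug d).map ((D.pathFunctor' r₂).map ((S.luniv hb p q σ).app ((D.pathFunctor' r₁).obj x)))
  -- the whiskered homotopy, through the naturality of `can_[γ₄]`
  rw [shadow_whisker_aux' (S.shP r₂) (fun z => S.canH r₂ z) (fun z => S.canI r₂ z)
    (fun g => S.canH_naturality r₂ g) (fun z => S.canH_canI r₂ z)
    ((S.luniv hb p q σ).app ((D.pathFunctor' r₁).obj x)) (S.canH p _)
    (σ.app _ ≫ S.canI q _) (S.map_luniv_app hb p q σ _),
    Functor.map_comp]
  -- the composite 2-cells, decomposed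
  rw [S.canH_comp r₁ (p.comp r₂), S.canH_comp p r₂, S.canI_comp r₁ (q.comp r₂), S.canI_comp q r₂,
    shP_comp_map, shP_comp_map]
  simp only [Category.assoc, eqToHom_trans, eqToHom_trans_assoc, eqToHom_refl, Category.id_comp]
  rw [lax_cancel σ (S.shP r₂) (S.canH r₁ x) (S.canI r₁ x) (S.canH_canI r₁ x)]
  simp only [eqToHom_comp_heq_iff]
  have eO : (D.pathFunctor' (r₁.comp (q.comp r₂))).obj x =
      (D.pathFunctor' r₂).obj ((D.pathFunctor' q).obj ((D.pathFunctor' r₁).obj x)) := by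
    rw [D.pathFunctor'_comp_obj, D.pathFunctor'_comp_obj]
  have eT := congrArg (S.aug d).obj eO
  exact heq_comp rfl rfl eT HEq.rfl (heq_comp rfl rfl eT HEq.rfl (heq_comp rfl rfl eT HEq.rfl
    (heq_comp rfl rfl eT HEq.rfl (comp_eqToHom_heq _ _))))

/-! ## Coherent systems of shadow 2-cells and the families of homotopies they determine -/

/-- **A coherent (lax) system of shadow 2-cells** on a pseudo-commuting shadow: a saturated set `R`
of co-verticial pairs (the future boundary set), for each `ϖ = ([γ₁],[γ₂]) ∈ R` a 2-cell
`σ_ϖ : sh_[γ₁] ⟶ sh_[γ₂]` between the SHADOWS satisfying the three axioms of Def 3.5 (ii) on the shadow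
(identity on the diagonal, composition, whiskering — the last componentwise), and a set `good` of
terminal vertices (containing those of all pairs of `R`) at which the augmentation will be required to
be fully faithful.  (t12's "equal shadows" is `R = {sh_[γ₁] = sh_[γ₂]}`, `σ = eqToHom`, `good = ⊤`.)
[cite: MochizukiAbsTopIII2015, Definition 3.5 (ii) p.75] -/
structure LaxCells : Type (max w (v + 1) (u + 1)) where
  /-- the pairs carrying a 2-cell -/
  R : ∀ ⦃a b : V⦄, Path a b → Path a b → Prop
  isSaturated : IsSaturated R
  /-- admissible terminal vertices -/
  good : V → Prop
  good_of : ∀ ⦃a b : V⦄ ⦃p q : Path a b⦄, R p q → good b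
  /-- the shadow 2-cell of a pair -/
  σ : ∀ ⦃a b : V⦄ ⦃p q : Path a b⦄, R p q → (S.shP p ⟶ S.shP q)
  σ_refl : ∀ ⦃a b : V⦄ ⦃p : Path a b⦄ (h : R p p), σ h = 𝟙 _
  σ_trans : ∀ ⦃a b : V⦄ ⦃p q r : Path a b⦄ (h₁ : R p q) (h₂ : R q r),
    σ (isSaturated.trans h₁ h₂) = σ h₁ ≫ σ h₂
  σ_whisker_app : ∀ ⦃a b c d : V⦄ ⦃p q : Path a b⦄ (h : R p q) (r₁ : Path c a) (r₂ : Path b d)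
    (y : S.Sh c),
    (σ (isSaturated.precomp (isSaturated.postcomp h r₂) r₁)).app y =
      eqToHom (by rw [S.shP_comp_obj, S.shP_comp_obj]) ≫
        (S.shP r₂).map ((σ h).app ((S.shP r₁).obj y)) ≫
        eqToHom (by rw [S.shP_comp_obj, S.shP_comp_obj])

variable (L : S.LaxCells) (ff : ∀ b : V, L.good b → (S.aug b).FullyFaithful)

/-- **The family of homotopies determined by a coherent system of shadow 2-cells** (boundary set `R`,
homotopy of `ϖ` = the lax universal homotopy over `σ_ϖ`), for augmentations fully faithful at the
admissible terminal vertices. [cite: MochizukiAbsTopIII2015, Definition 3.5 (ii) p.75] -/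
noncomputable def laxFamily : D.HomotopyFamily :=
  HomotopyFamily.mkOfStrict L.R L.isSaturated
    (fun ⦃_ b⦄ ⦃p q⦄ h => S.luniv (ff b (L.good_of h)) p q (L.σ h))
    (fun ⦃_ b⦄ ⦃p⦄ h => by rw [L.σ_refl h]; exact S.luniv_id (ff b (L.good_of h)) p)
    (fun ⦃_ b⦄ ⦃p q r⦄ h₁ h₂ => by
      rw [L.σ_trans h₁ h₂]; exact S.luniv_comp (ff b _) p q r (L.σ h₁) (L.σ h₂))
    (fun ⦃_ b _ d⦄ ⦃p q⦄ h r₁ r₂ =>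
      S.luniv_whisker (ff b (L.good_of h)) (ff d _) p q (L.σ h) r₁ r₂ _ (L.σ_whisker_app h r₁ r₂) _ _)

/-- The boundary set of the lax family is `R`. [cite: MochizukiAbsTopIII2015, Definition 3.5 (ii) p.75] -/
theorem laxFamily_E {a b : V} (p q : Path a b) : (S.laxFamily L ff).E p q ↔ L.R p q := Iff.rfl

/-- The homotopies of the lax family are the lax universal homotopies (transported to t2's path
functors). [cite: MochizukiAbsTopIII2015, Definition 3.5 (ii) p.75] -/
theorem laxFamily_η {a b : V} {p q : Path a b} (h : (S.laxFamily L ff).E p q) :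
    (S.laxFamily L ff).η h = eqToHom (D.pathFunctor_eq_pathFunctor' p) ≫
      S.luniv (ff b (L.good_of h)) p q (L.σ h) ≫ eqToHom (D.pathFunctor_eq_pathFunctor' q).symm :=
  rfl

/-- Components of the homotopies of the lax family lie over `can_[γ₁] ≫ σ_ϖ ≫ can_[γ₂]⁻¹`.
[cite: MochizukiAbsTopIII2015, Definition 3.5 (ii) p.75] -/
theorem map_laxFamily_η_app {a b : V} {p q : Path a b} (h : (S.laxFamily L ff).E p q)
    (x : D.obj a) :
    (S.aug b).map (((S.laxFamily L ff).η h).app x) =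
      eqToHom (by rw [D.pathFunctor_eq_pathFunctor']) ≫ S.canH p x ≫
        (L.σ h).app ((S.aug a).obj x) ≫ S.canI q x ≫
        eqToHom (by rw [D.pathFunctor_eq_pathFunctor']) := by
  rw [laxFamily_η, NatTrans.comp_app, NatTrans.comp_app, eqToHom_app, eqToHom_app,
    Functor.map_comp, Functor.map_comp, eqToHom_map, eqToHom_map, map_luniv_app]
  simp only [Category.assoc]

/-- **Uniqueness for the lax family**: a natural transformation (between t2's path functors) lying
over `can_[γ₁] ≫ σ_ϖ ≫ can_[γ₂]⁻¹` IS the family's homotopy of `ϖ` — the tool identifying pinned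
homotopies. [cite: MochizukiAbsTopIII2015, Definition 3.5 (ii) p.75] -/
theorem laxFamily_η_eq {a b : V} {p q : Path a b} (h : (S.laxFamily L ff).E p q)
    (φ : D.pathFunctor p ⟶ D.pathFunctor q)
    (hφ : ∀ x, (S.aug b).map (φ.app x) ≍
      S.canH p x ≫ (L.σ h).app ((S.aug a).obj x) ≫ S.canI q x) :
    φ = (S.laxFamily L ff).η h := by
  rw [laxFamily_η]
  have hu := S.luniv_eq (ff b (L.good_of h)) (L.σ h)
    (eqToHom (D.pathFunctor_eq_pathFunctor' p).symm ≫ φ ≫ eqToHom (D.pathFunctor_eq_pathFunctor' q))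
    fun x => by
      rw [NatTrans.comp_app, NatTrans.comp_app, eqToHom_app, eqToHom_app, Functor.map_comp,
        Functor.map_comp, eqToHom_map, eqToHom_map]
      exact ((conj_eqToHom_iff_heq' _ _ _ _).mpr (hφ x).symm).symm
  rw [← hu]
  simp

end PseudoShadow

end DiagramOfCategories

end Literature.AnabelianGeometry.AbsoluteAnabelian
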